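import Summits.BirchSwinnertonDyer.Rank1Residual.Additive.StrictSelmerDominatesShaAlgebra
import Literature.NumberTheory.EllipticCurves.StrictSelmerRankOne
import HarnessLib

/-!
# (P4♯) — local and algebraic lemmas for `Additive.StrictSelmerIndexAt`: a Kummer class of exact
# local level is locally trivial; exact `p`-divisibility level in a group with `λ : G → ℤ_p` and no
# `p`-torsion (cell `b2b-bsdres`, lane CLASS-CLOSURE, O10 class lead x1b GEN 30; the count and the
# discharge of cc-typer-6's typed input p307042 §3 are the sequel `StrictSelmerIndex.lean`; companion
# of n1011-p01's p263184 `StrictSelmerDominatesShaAlgebra.lean`)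

HONEST FRAMING (cell `b2b-bsdres`, run/shared/lean/b2b/bsd-rank1-residual/, verbatim in every
file): prove what is provable now; shrink each hard class to its core with data; no claim beyond
stated classes. Research routes; nothing is booked; no label changes. Elementary algebra and one
Galois-cohomology lemma over the tree's `p^∞` Kummer theory (`SelmerCorankProofs`); THEOREMS ONLY —
NO definition, NO Literature fact, NO `sorry`; each lemma is useful alone.

* §1 `kummerMapLevel_mem_selmerLocalKerPrimaryTorsion_of_eq_nsmul` (class-free, any field `K`, any
  `K`-field `E`): if `P = p^N • R` in `E(E)` then the level-`N` Kummer class `κ_N(P)` dies in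
  `H¹(E, E(Ē)[p^∞])` (lies in `selmerLocalKerPrimaryTorsion W E p`) — the local Kummer map is
  well defined on `E(E) ⊗ ℚ_p/ℤ_p`; converse (up to torsion) = the tree's
  `exists_eq_nsmul_add_of_res_kummerMapLevel_eq_zero`.
* §2 pure algebra in an additive group `G` with `λ : G → ℤ_p` vanishing exactly on torsion and no
  point of order `p`: no `p`-power torsion; torsion points are `p^m`-divisible; and the VALUATION
  LEMMA `le_add_padicValInt_of_zsmul_eq_nsmul_add`: if `X₀ = pⁿQ` has no `pⁿ⁺¹`-th root then
  `k·X₀ ∈ p^N G + G_tors ⟹ N ≤ n + v_p(k)` (`k ≠ 0`) — "`v_p(loc P) = n` in `E(ℚ_p)/tors ≅ ℤ_p`"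
  (AEC VII.6.3) without choosing the isomorphism; plus `zsmul_eq_zero_of_isOfFinAddOrder`.

References: [GreenbergLNM1716] §2 (pp. 62–63); [SilvermanAEC2009] Prop. VII.6.3, VIII.§1–2;
[SerreGaloisCohomology1997] I.§2.4, I.§5.1.
-/

noncomputable section

open scoped Classical

open WeierstrassCurve Literature.NumberTheory.EllipticCurves Literature.NumberTheory.GaloisRepresentations

universe u

namespace Summit.BirchSwinnertonDyer.Rank1Residual.Additive.StrictSha

/-! ### §1 Local triviality of `κ_N(P)` when `P ∈ p^N E(E)` exactly -/

/-- **A Kummer class of exact local level is locally trivial.** Let `K` be a field, `E/K` elliptic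
(`W`), `p` prime, `E ⊇ K` a `K`-field, `P ∈ E(K)` and `R ∈ E(E)` with `P = p^N • R` in `E(E)`. Then
the level-`N` Kummer class `κ_N(P) = [σ ↦ σQ − Q]` (`p^N Q = P` in `E(K̄)`) dies in
`H¹(E, E(Ē)[p^∞])`, i.e. `κ_N(P) ∈ selmerLocalKerPrimaryTorsion W E p`: on `Γ_E` the cocycle is the
coboundary of `z := ιQ − ι_E R ∈ E(Ē)[p^N]` (`ι_E R` is `Γ_E`-fixed). The converse direction (up to
torsion) is the tree's `exists_eq_nsmul_add_of_res_kummerMapLevel_eq_zero`.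
Greenberg LNM 1716 §2 pp. 62–63 (the local Kummer map `E(E) ⊗ ℚ_p/ℤ_p ↪ H¹(E, E[p^∞])`).
[cite: GreenbergLNM1716, §2 (pp. 62–63)] -/
theorem kummerMapLevel_mem_selmerLocalKerPrimaryTorsion_of_eq_nsmul {K : Type u} [Field K]
    (W : WeierstrassCurve K) [W.IsElliptic] (p : ℕ) [Fact p.Prime]
    (hdiv : W.zsmul_geomPoints_surjective) (E : Type u) [Field E] [Algebra K E]
    (N : ℕ) (P : W.toAffine.Point) (R : (W.baseChange E).toAffine.Point)
    (h : Affine.Point.baseChange (W' := W) K E P = p ^ N • R) :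
    kummerMapLevel W p hdiv N P ∈ selmerLocalKerPrimaryTorsion W E p := by
  have hQn := nsmul_kummerRoot W p hdiv N P
  set Q := kummerRoot W p hdiv N P with hQdef
  rw [kummerMapLevel_eq_kummerClass W p hdiv N P Q hQn]
  change oneCocycleClass _ (kummerCocycle W p N Q (smul_nsmul_of_nsmul_eq W p hQn)) ∈ _
  refine (oneCocycleClass_mem_resKer_iff (resGal (K := K) E) (primaryPointsMap W E p)
    (primaryPointsMap_smul W E p) _).mpr ?_
  -- the `E`-rational points inside `E(Ē)` and the comparison `ι(P) = ι_E(bc P)`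
  let ιE : (W.baseChange E).toAffine.Point →+ localPoints W E :=
    Affine.Point.map (W' := W) (IsScalarTower.toAlgHom K E (AlgebraicClosure E))
  have hιE : ∀ X : (W.baseChange E).toAffine.Point,
      Affine.Point.map (W' := W) (IsScalarTower.toAlgHom K E (AlgebraicClosure E)) X = ιE X :=
    fun _ => rfl
  have hjP : pointsMap W E (toGeomPoints W P) = ιE (Affine.Point.baseChange (W' := W) K E P) := by
    change Affine.Point.map (closureEmb (K := K) E)
        (Affine.Point.baseChange (W' := W) K (AlgebraicClosure K) P) =
      Affine.Point.map _ (Affine.Point.baseChange (W' := W) K E P)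
    rw [Affine.Point.map_baseChange, Affine.Point.map_baseChange]
  -- the `p`-power-torsion element `z := ι Q − ι_E R`
  have hz : p ^ N • (pointsMap W E Q - ιE R) = 0 := by
    rw [smul_sub, ← map_nsmul, hQn, hjP, h, map_nsmul, sub_self]
  refine ⟨⟨pointsMap W E Q - ιE R, (AddCommGroup.mem_primaryComponent).2 ⟨N, hz⟩⟩, fun τ => ?_⟩
  apply Subtype.ext
  change pointsMap W E (((kummerCocycle W p N Q (smul_nsmul_of_nsmul_eq W p hQn)).1
      (resGal (K := K) E τ) : geomPrimaryTorsion W p) : geomPoints W) =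
    τ • (pointsMap W E Q - ιE R) - (pointsMap W E Q - ιE R)
  rw [coe_kummerCocycle_apply, map_sub, pointsMap_smul, smul_sub,
    smul_eq_of_map_eq W E τ R (hιE R)]
  abel

/-! ### §2 Algebra: exact `p`-divisibility level in a group with `λ : G → ℤ_p` and no `p`-torsion -/

/-- No `p`-torsion ⟹ no `p`-power torsion. [folklore] -/
theorem eq_zero_of_pow_nsmul_eq_zero {G : Type*} [AddCommGroup G] {p : ℕ}
    (hnoTors : ∀ X : G, p • X = 0 → X = 0) {b : ℕ} {T : G} (hT : p ^ b • T = 0) : T = 0 := by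
  induction b with
  | zero => simpa using hT
  | succ b ih =>
    apply ih
    apply hnoTors
    rwa [← mul_smul, ← pow_succ']

/-- In a group without `p`-torsion, every torsion point is `p`-divisible (indeed `p^m`-divisible):
`T = p^m • T'` with `T'` torsion (Bezout split `T = T₁ + p^m T₂`, `p^b T₁ = 0 ⟹ T₁ = 0`). [folklore] -/
theorem exists_eq_pow_nsmul_of_isOfFinAddOrder {G : Type*} [AddCommGroup G] (p : ℕ) [Fact p.Prime]
    (hnoTors : ∀ X : G, p • X = 0 → X = 0) {T : G} (hT : IsOfFinAddOrder T) (m : ℕ) :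
    ∃ T' : G, T = p ^ m • T' := by
  obtain ⟨T₁, T₂, b, hT₁, hTeq⟩ := exists_eq_add_nsmul_of_isOfFinAddOrder p hT m
  refine ⟨T₂, ?_⟩
  rw [hTeq, eq_zero_of_pow_nsmul_eq_zero hnoTors hT₁, zero_add]

/-- **Exact level forces the local divisibility bound.** Let `G` carry `λ : G → ℤ_p` vanishing
exactly on torsion, with no `p`-torsion; let `X₀ = p^n • Q` with NO `Q'` such that
`p^(n+1) • Q' = X₀`. If `k • X₀ = p^N • R + T` with `T` torsion and `k ≠ 0`, then `N ≤ n + v_p(k)`.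
(Else, with `k = p^v k₁`, `p ∤ k₁`: `k₁ λQ = p^{N−n−v} λR`, so `k₁ Q − p^{N−n−v} R` is torsion; Bezout
`αk₁ + βp = 1` writes `Q = p • Q₂ + (torsion) = p • Q'`, contradicting the exact level.) This is the
valuation bookkeeping "`v_p(loc P) = n`" of `E(ℚ_p)/tors ≅ ℤ_p` (AEC VII.6.3) done without choosing
the isomorphism. [cite: SilvermanAEC2009, Prop. VII.6.3] [cite: GreenbergLNM1716, §2 (pp. 62–63)] -/
theorem le_add_padicValInt_of_zsmul_eq_nsmul_add {G : Type*} [AddCommGroup G] (p : ℕ) [Fact p.Prime]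
    (lam : G →+ ℤ_[p]) (hlam : ∀ X, lam X = 0 ↔ IsOfFinAddOrder X)
    (hnoTors : ∀ X : G, p • X = 0 → X = 0) {n : ℕ} {Q : G}
    (hndiv : ∀ Q' : G, p ^ (n + 1) • Q' ≠ p ^ n • Q) {k : ℤ} (hk : k ≠ 0) {N : ℕ} {R T : G}
    (hT : IsOfFinAddOrder T) (h : k • (p ^ n • Q) = p ^ N • R + T) :
    N ≤ n + padicValInt p k := by
  have hp : p.Prime := Fact.out
  have hp0 : (p : ℤ_[p]) ≠ 0 := by exact_mod_cast hp.ne_zero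
  by_contra hlt
  rw [not_le] at hlt
  set v := padicValInt p k with hv
  -- `k = p^v k₁`, `p ∤ k₁`
  obtain ⟨k₁, hk₁⟩ : (p : ℤ) ^ v ∣ k := padicValInt_dvd k
  have hk₁p : ¬ (p : ℤ) ∣ k₁ := by
    intro hdvd
    have h1 : (p : ℤ) ^ (v + 1) ∣ k := by rw [hk₁, pow_succ]; exact mul_dvd_mul_left _ hdvd
    rcases (padicValInt_dvd_iff (v + 1) k).mp h1 with h0 | hle
    · exact hk h0
    · omega
  obtain ⟨d, hd⟩ : ∃ d, N = n + v + (d + 1) := ⟨N - (n + v) - 1, by omega⟩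
  -- apply `λ` and cancel `p^(n+v)` in the domain `ℤ_p`
  have hlamQ : (k₁ : ℤ_[p]) * lam Q = (p : ℤ_[p]) ^ (d + 1) * lam R := by
    have h1 := congrArg lam h
    rw [map_zsmul, map_nsmul, map_add, map_nsmul, (hlam T).mpr hT, add_zero, hk₁, hd,
      zsmul_eq_mul, nsmul_eq_mul, nsmul_eq_mul] at h1
    push_cast at h1
    have h2 : (p : ℤ_[p]) ^ (n + v) * ((k₁ : ℤ_[p]) * lam Q) =
        (p : ℤ_[p]) ^ (n + v) * ((p : ℤ_[p]) ^ (d + 1) * lam R) := by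
      rw [pow_add, pow_add, pow_add] at *
      linear_combination h1
    exact mul_left_cancel₀ (pow_ne_zero _ hp0) h2
  -- `k₁ Q − p^(d+1) R` is torsion, hence `p`-divisible (no `p`-torsion)
  have hT'' : IsOfFinAddOrder (k₁ • Q - p ^ (d + 1) • R) := by
    rw [← hlam, map_sub, map_zsmul, map_nsmul, zsmul_eq_mul, nsmul_eq_mul, Nat.cast_pow, hlamQ,
      sub_self]
  obtain ⟨T₃, hT₃⟩ := exists_eq_pow_nsmul_of_isOfFinAddOrder p hnoTors hT'' 1
  rw [pow_one] at hT₃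
  -- Bezout `a p + b k₁ = 1` writes `Q = p • Q'`
  have hcop : IsCoprime (p : ℤ) k₁ :=
    (Irreducible.coprime_iff_not_dvd (Nat.prime_iff_prime_int.mp hp).irreducible).mpr hk₁p
  obtain ⟨a, b, hab⟩ := hcop
  apply hndiv (a • Q + (b * (p : ℤ) ^ d) • R + b • T₃)
  have habQ : (a * (p : ℤ) + b * k₁) • Q = (1 : ℤ) • Q := by rw [hab]
  have hT₃' : (b * k₁) • Q - (b * (p : ℤ) ^ (d + 1)) • R = ((p : ℤ) * b) • T₃ := by
    rw [mul_smul, mul_smul, mul_comm (p : ℤ) b, mul_smul, ← Nat.cast_pow, natCast_zsmul,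
      natCast_zsmul, ← smul_sub, hT₃]
  have hQ : p • (a • Q + (b * (p : ℤ) ^ d) • R + b • T₃) = Q := by
    rw [← natCast_zsmul]
    rw [one_smul] at habQ
    conv_rhs => rw [← habQ]
    rw [smul_add, smul_add, smul_smul, smul_smul, smul_smul, add_smul, ← hT₃']
    rw [show (p : ℤ) * (b * (p : ℤ) ^ d) = b * (p : ℤ) ^ (d + 1) by ring, mul_comm (p : ℤ) a]
    abel
  rw [pow_succ, mul_smul, hQ]

/-- A multiple `c • P` of a point of infinite order is torsion only if `c = 0`. [folklore] -/
theorem zsmul_eq_zero_of_isOfFinAddOrder {G : Type*} [AddCommGroup G] {P : G}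
    (hP : ¬ IsOfFinAddOrder P) {c : ℤ} (hc : IsOfFinAddOrder (c • P)) : c = 0 := by
  by_contra hc0
  obtain ⟨M, hM, hMc⟩ := isOfFinAddOrder_iff_zsmul_eq_zero.mp hc
  exact hP (isOfFinAddOrder_iff_zsmul_eq_zero.mpr ⟨M * c, mul_ne_zero hM hc0, by rw [mul_smul, hMc]⟩)


end Summit.BirchSwinnertonDyer.Rank1Residual.Additive.StrictSha

end
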